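import Mathlib
import HarnessLib
import HarnessLib.Audit
import Summits.HodgeConjecture.Statement
import Literature.AlgebraicGeometry.HodgeTheory.AbsoluteHodgeClasses
import Literature.AlgebraicGeometry.HodgeTheory.GysinFormalism
import Literature.AlgebraicGeometry.HodgeTheory.HodgeModelExistence
import Literature.AlgebraicGeometry.Motives.FamiliesVHS
import Literature.AlgebraicGeometry.Motives.BaseChange

/-!
Route: BoundaryReadout

DORMANT since 2026-08-26T16:14:28Z (reconciler: no traction for 5.5 d (last activity item-evidence-added at 2026-08-21T04:16:45Z); parked, not closed — `ledger route dormant route-HodgeConjecture-BoundaryReadout --off` to reactivate) — unstaffed, not closed; items shared with open routes are served there. `ledger route dormant <id> --off` reactivates.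

# Route BoundaryReadout — Hodge ⇒ absolute by boundary readout — absoluteness is inherited from any
covered fibre; then Voisin's ℚ̄-funnel

It suffices to show X = HodgeIsAbsolute ∧ HCOverNumberFields, where HodgeIsAbsolute (Charles–Schnell
Conj. 11.2.17: every rational
(p,p) class on a smooth projective complex variety is an absolute Hodge class) is attacked by
BOUNDARY READOUT, the lever of card
boundary-principle-b-cusp-readout made into two typed items: BoundaryAbsoluteness
(theorem-candidate, the engine: for f : 𝒳 → C from a smooth
projective total space onto a smooth projective curve and a global rational (p,p) class ξ, if the
fibre over one point o is COVERED by finitely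
many smooth projective Y_i → X_o on which ξ is absolute Hodge, then ξ|X_t is absolute Hodge on every
smooth projective fibre — no semistability,
monodromy, level or interior-anchor hypothesis) and BoundarySupply (every Hodge class (X, c) is
pulled back from such a ξ|X_t: the class is
driven, inside its Hodge locus, to a fibre covered by pieces where absoluteness is already known —
dim ≤ 3, uniruled fourfolds, abelian type,
cellular/toric, HC-known). HCOverNumberFields is the shared crux of route QbarEnvelope;
Voisin2007HodgeLoci Prop. 1.2 (crux AbsoluteReduction)
turns absolute + HC(ℚ̄) into algebraic (and carries the proved Hodge-model existence fact), and
PullbackAlgebraic closes the summit; after the crux-only repair (rev 1–4) all five hypotheses of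
`closes` are cruxes: BoundarySupply, BoundaryAbsoluteness, HCOverNumberFields, AbsoluteReduction,
PullbackAlgebraic.
Lean: `BoundarySupply ∧ BoundaryAbsoluteness ∧ HCOverNumberFields`

## Assembly
Pure logic, certified in glue.lean (`closes hS hB hQ hR hP : _root_.HodgeConjecture`, five crux
hypotheses, re-certified at rev 6, lean rc 0): given X smooth projective and a
rational (p,p) class c, BoundarySupply yields (𝒳, C, f, o, t, Y_i, g_i, ξ, e) with c = e^*(ξ|X_t);
BoundaryAbsoluteness makes ξ|X_t absolute
Hodge on the smooth projective fibre X_t; AbsoluteReduction (fed HCOverNumberFields) makes ξ|X_t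
algebraic; PullbackAlgebraic carries
algebraicity along e to c; the anti-vacuity conjunct of HodgeConjectureFor is the first conjunct of
AbsoluteReduction (tree fact nonempty_hodgeModel_holds). Every crux is used;
the deciding theorem is `closes` (crux-only since rev 2), and the Assembly item records the same
implication as a statement (provable now by the glue proof).

Rationale: WHY THIS LINE. Deligne's Principle B (Deligne1982HodgeCycles Thm 2.12) and André's deformation
principle move absoluteness between SMOOTH fibres and need an
interior anchor; Voisin2007HodgeLoci (Lemma 2.4, Thm 1.5), KlinglerOtwinowskaUrbanik2023,
Kreutz2021AbsolutelySpecial, Urbanik2022 get (weak)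
absoluteness from monodromy/definability hypotheses; Saito–Schnell (KerrPearlstein2016, Fields of
definition of Hodge loci, Thm 1–2, Cor. 1–3)
need a ℚ̄-point of the OPEN base. The boundary is where geometry degenerates to pieces on which
"Hodge = absolute" is a theorem, and mixed
Hodge theory (DeligneHodgeIII1974 §8.1: ker(H^2k(X_o) → ⊕H^2k(Y_i)) = W_(2k−1);
Steenbrink1976/Clemens1977/Schmid1973: sp : H(X_o) → H_lim is
a morphism of ℚ-MHS; the global part is pure of weight 2k in H_lim, hence meets W_(2k−1) in 0) pins
the ℚ-position of every σ-conjugate of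
ξ|X_t from its Gr^W-image, i.e. from the conjugates of the ξ|Y_i (a q-expansion principle for Hodge
classes). Imported areas: limit mixed
Hodge structures and the Clemens–Schmid package (degenerations), algebraic de Rham cohomology and
Aut(ℂ)-conjugation (arithmetic of periods),
degeneration geometry of Calabi–Yau/surface families (Tyurin and LCS boundaries: arXiv:1601.08110,
arXiv:2404.12422) for the supply. What
prior routes do not do: QbarEnvelope's Envelope uses interior ℚ̄-anchors (KOU/André) and is weaker
than absoluteness; AnchorTransport transports
ALGEBRAICITY from an interior algebraic anchor (variational HC); TateCuspKLift ASSUMES absoluteness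
at a ℚ̄-Tate cusp and builds K-classes
(opposite half); none transports σ-conjugates through Gr^W of a degenerate fibre. Negatives index (2
refuted Fermat/K3-lattice statements) untouched.

RANKED CRUXES. #2 BoundarySupply (crux) — every rational (p,p) class c on a smooth projective X is
e^*(ξ|X_t) for some ℂ-morphism e : X → X_t into a smooth projective fibre of some f : 𝒳 → C (𝒳
smooth projective, C a smooth projective curve, f surjective), ξ a rational (p,p) class on 𝒳, such
that the fibre over some o ∈ C(ℂ) is covered by finitely many smooth projective Y_i → X_o with every
ξ|Y_i absolute Hodge (card K2 "cusp supply" + K3 "cusp descent", ∃-form on the tree's real carriers;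
trivially true where c is already known absolute — constant family — so its content is exactly the
classes not known absolute: degenerate inside the Hodge locus onto absolute-type pieces).
[difficulty: open-problem] (why it might fail: Rigid classes (isolated in their Hodge locus) sit
only in isotrivial families, where the statement is their absoluteness outright; movable loci may
reach only boundaries carrying a full-dimensional component of unknown type. HC-safe: false only
with Conj. 11.2.17.) [Voisin2007HodgeLoci, CattaniDeligneKaplan1995JAMS, arXiv:1601.08110,
arXiv:2404.12422, ConteMurre1978, Deligne1982HodgeCycles, KerrPearlstein2016]
#3 BoundaryAbsoluteness (crux) — BOUNDARY PRINCIPLE B (card K1, generalised: no semistability). f :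
𝒳 → C surjective, 𝒳 smooth projective of dim N, C a smooth projective curve, o ∈ C(ℂ); finitely many
smooth projective Y_i → X_o jointly covering the fibre; ξ ∈ H^2p(𝒳(ℂ);ℂ) rational of type (p,p) with
every ξ|Y_i absolute Hodge ⟹ ξ|X_t is absolute Hodge on every smooth projective fibre X_t. Proof
sketch: for σ ∈ Aut ℂ, ξ^σ|Y_i^σ = twist·(rational) by hypothesis; (r_i) = Gr^W_2p(ξ^σ|X_o^σ) (Hodge
III 8.2); sp is a morphism of ℚ-MHS and sp(ξ^σ|X_o^σ) = image of ξ^σ in H_lim; that image lies in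
W'⊗ℂ, W' := im(H^2p(𝒳^σ) → H_lim) pure of weight 2p, so W'_ℚ ↪ Gr^W_2p H_lim,ℚ; a vector of W'⊗ℂ
with rational Gr-image is rational; F^p is preserved by σ on algebraic de Rham cohomology.
[difficulty: L] (why it might fail: Unprinted theorem-candidate: needs sp : H(X_o) → H_lim a
morphism of ℚ-MHS for NON-semistable fibres (via semistable base change), purity of the global part
in H_lim, conjugation charts commuting with fibre inclusions; a ℚ-structure mismatch off ker N would
leak.) [DeligneHodgeIII1974, Steenbrink1976, Clemens1977, Schmid1973, PetersSteenbrink2008,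
Voisin2007HodgeLoci, arXiv:1210.5301, Deligne1982HodgeCycles, CharlesSchnell2014Notes]
#4 HCOverNumberFields (crux) — the Hodge conjecture for smooth projective complex varieties
definable over a number field (X ≅ X₀ ⊗_(K,σ) ℂ) — VERBATIM the crux HCOverNumberFields of route
QbarEnvelope (stmt-HodgeConjecture-1070; one item, one staffing). [difficulty: open-problem] (why it
might fail: It is HC on ℚ̄-varieties: open already for Weil classes on CM abelian varieties of Weil
type from dimension 6 on (failure there also refutes standard conjecture B, André); as typed it also
asks Nonempty (HodgeModel n X).) [Deligne1982HodgeCycles, Andre1996Motifs, Voisin2007HodgeLoci,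
CharlesSchnell2014Notes, arXiv:2603.20268]
#9 AbsoluteReduction (support) — Voisin2007HodgeLoci Prop. 1.2 (theorem in print;
CharlesSchnell2014Notes Thm 11.3.19): if HC holds for varieties over number fields then every (de
Rham) absolute Hodge class on any smooth projective complex variety is algebraic — spread over ℚ̄
(the Hodge locus of an absolute class is over ℚ̄), ℚ̄-compactify, lift by the global invariant cycle
theorem + semisimplicity to an absolute Hodge class on the ℚ̄-total space, apply HC(ℚ̄), restrict.
[difficulty: L] [Voisin2007HodgeLoci, CharlesSchnell2014Notes, DeligneHodgeII1971]
#9 PullbackAlgebraic (support) — pull-back along a ℂ-morphism of smooth projective varieties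
preserves algebraic classes — VERBATIM QbarEnvelope.PullbackAlgebraic (stmt-HodgeConjecture-1071).
[difficulty: provable-now] [Fulton1998, VoisinHodgeII2003]
#9 HodgeModels (support) — smooth projective complex varieties have Hodge models — VERBATIM
QbarEnvelope.HodgeModels (stmt-HodgeConjecture-1943, proved by
Theorems.nodalSupport_hodgeModels_proof). [difficulty: provable-now] [SerreGAGA1956,
VoisinHodgeI2002]

TWO-LAYER PLAN. Foreseen glued splits (none filed now): BoundarySupply ⇐ MovableBoundaries (classes
with positive-dimensional Hodge locus: an arc of the
locus in a ℚ̄-compactified family ends at a fibre covered by HC-known pieces — Tyurin/LCS boundaries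
of CY₃×CY₃ and CY₄ loci, d-planes points
of surface loci, toroidal cusps) → RigidAbsolute (classes isolated in their Hodge locus are absolute
— the dark case, to be attacked with the
rigid-pair cards) → BoundarySupply; BoundaryAbsoluteness ⇐ CoveredFibreWeights (ker(H^2k(X_o) →
⊕H^2k(Y_i)) = W_(2k−1), Hodge III) →
FixedPartStrict (sp morphism of ℚ-MHS + purity of the global part in H_lim, incl. the non-semistable
case) → BoundaryAbsoluteness.

KILL CRITERIA. All three cruxes are HC-safe except the engine: (i) BoundaryAbsoluteness REFUTED as
typed (a leak in the ℚ-structures, or a degenerate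
configuration the hypotheses admit) kills the line — close `refuted:BoundaryAbsoluteness` unless the
witness is a typing artefact (then
restate with the missing hypothesis, e.g. semistability, and say so); (ii) a no-go theorem showing
that for an explicit non-abelian-type sector
(e.g. extra Hodge endomorphisms of T(S), S ⊂ ℙ³ of degree ≥ 5; rank-2 splittings of H³ of
multi-parameter CY₃ families) every Hodge-locus arc
ends only at fibres with a full-dimensional component of unknown type empties BoundarySupply there —
pivot to the induction through partial
boundaries (card K3) or retire; (iii) ¬HCOverNumberFields or a non-absolute Hodge class refutes HC
itself (route and summit settle together);
(iv) Conj. 11.2.17 proved elsewhere (e.g. by QbarEnvelope's engine in full) moots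
BoundarySupply/BoundaryAbsoluteness, and the route merges
into the Voisin funnel.

NOT DECOMPOSED YET. The movable/rigid split of BoundarySupply (needs a typed 'isolated in its Hodge
locus' over VHSData — layer 2); the concrete supply sectors
(Tyurin degenerations of CY fourfolds inside W = 0 loci, arXiv:2404.12422/arXiv:1601.08110;
surface-endomorphism loci through the d-planes
point; MUM points of multi-parameter CY₃ families) as children of BoundarySupply; the named-fact
packaging of the LMHS/Clemens–Schmid inputs
of BoundaryAbsoluteness (definition requests below); the ℓ-adic half of absoluteness (tree keeps de
Rham only, as Voisin/Charles–Schnell).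

CHEAPEST FALSIFIER. For the engine: the non-semistable case — take the Dwork pencil of elliptic
curves (or E_s × E_t over X₀(2)) WITHOUT semistable reduction at
an additive fibre and run (i)–(iv) by hand: sp must still be a morphism of ℚ-MHS after factoring
through the semistable model (Peters–Steenbrink
Thm 11.29 ff.); a mismatch of ℚ-structures on T-invariants would show up as a (2πi)-type discrepancy
in the de Rham coordinates of the 2-isogeny
graph. For the supply: one hour with Doran–Harder–Thompson (arXiv:1601.08110): does a W = 0 flat
direction of a two-parameter CY fourfold reach
the LCS point with a semistable model all of whose components are toric/uniruled? Run: not yet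
(paper computation, no kit job needed).

NUMBERS. Absoluteness known: abelian varieties and abelian-type motives (Deligne1982HodgeCycles,
Andre1996Motifs), HK of known deformation types
(arXiv:1904.11320), all classes on varieties of dim ≤ 3 and on uniruled fourfolds (HC known:
Lefschetz (1,1) + hard Lefschetz; ConteMurre1978),
weakly non-factor positive-dimensional loci of level ≥ 3 (KlinglerOtwinowskaUrbanik2023 Thm 1.12).
Unknown: every other sector, e.g. CY₃ × CY₃
projectors, surfaces with p_g ≥ 2, CY₄ flux classes. Items at open: 6 (3 cruxes, 3 supports; 3
shared with QbarEnvelope).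

DEFINITION REQUESTS. Lean lacks the limit mixed Hodge structure / nearby cycles, the specialisation
map sp and the Clemens–Schmid sequence; BoundaryAbsoluteness is
TYPED without them (hypotheses and conclusion are the tree's IsAbsoluteHodgeClass on smooth
projective schemes), but its proof needs them as
named facts over Motives/FamiliesVHS (to be filed by the prover/grounder as `--kind cite` facts:
Steenbrink1976 sp-is-MHS-morphism, DeligneHodgeIII1974
8.2.5 weight kernel, global-part purity). Also wanted: functoriality of conjugation charts under
closed immersions (tree: AbsoluteHodgeClasses.conjHom).

Novelty: Searches (2026-08-16): `lit frontier HodgeConjecture --since 2023` (30 rows; 2606.08882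
G-operators/Hodge-generic density, 2603.20268 Weil sixfolds,
2605.20453 moduli of curves — no boundary transport of absoluteness); `lit search --source arxiv
"absolute Hodge classes" --year-from 2019` (12:
2509.07672 Luo — weighted toroidal varieties, extension across a boundary divisor of ONE variety,
different object and unreliable; 2401.03465 Bouali —
claimed HC via nearby cycles of hypersurface families, opposite direction, autopsied in card
bouali-log-classes-autopsy; 1904.11320 Soldatenkov —
interior deformation principle for HK); `lit search --source zbmath "absolute Hodge degeneration"`
(4; + p-adic absolute Hodge cohomology, unrelated);
`lit galaxy search "absolute Hodge classes degeneration" --star all` and `"absolute Hodge limit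
mixed Hodge structure" --star all` (0, 0);
`lit search --hybrid "absolute Hodge class semistable degeneration fixed part limit mixed Hodge
structure"` (10 held books: GGK 2012 ch. VI–VIII fields
of definition of NL components via CM density — interior; KerrPearlstein2016 pp. 271–288 =
Saito–Schnell, read: Thm 1–2 need a k-point of the OPEN
base, Remark 2.3 Baire argument; Deligne LNM 900 pp. 16–33 Principle B smooth); `lit read
arXiv:math/0605766` pp. 2–7 (Prop. 1.2 proof, Thm 1.5);
`lit bridges HodgeConjecture --cross any` (generic). OpenAlex/S2 HTTP 429. Plus the card's own
search log and the mechanism critic's (refuter-mechcritic-2280, 2026-08-16).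
Ne  [refs: math/0605766, 1210.5301, KerrPearlstein2016]

Barriers (technique_class: boundary-principle-b, limit-mhs, absolute-hodge): - technique_class: boundary-principle-b, limit-mhs, absolute-hodge
- Literature.Barriers.HodgeConjecture.Charles2009_conjugateVarieties_cohomologyAlgebrasNotIso:
CONFRONTED, not dodged — σ ∈ Aut ℂ never moves a Betti class or compares X with X^σ topologically
(Serre 1964 / Charles 2009 witnesses untouched); only algebraic de Rham classes, restriction to the
covering pieces, Gr^W and sp travel, all ℚ-rational on the Betti side of X^σ itself.
-
Literature.Barriers.HodgeConjecture.Bloch1990_cohomologicalHodgeConjecture_singular_counterexample: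
evaded — no cohomological cycle map on the singular fibre X_o is used; Gr^W_2p H^2p(X_o) =
compatible tuples on the smooth covering pieces, and Bloch's exotic classes live in W_(2p−1),
exactly what strictness discards.
-
Literature.Barriers.HodgeConjecture.BarbieriVialeSrinivas1994_singularLefschetzOneOne_counterexample:
idem — Lefschetz (1,1) is never invoked on the singular fibre; all absoluteness/algebraicity
statements concern smooth projective Y_i, X_t.
- Literature.Barriers.HodgeConjecture.CattaniDeligneKaplan1995_hodgeLocus_algebraicFor: used
positively (the supply arcs are algebraic curves); its open half (field of definition) is what
BoundaryAbsoluteness + Saito–Schnell/Voisin deliver along supplied arcs.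
- Literature.Barriers.HodgeConjecture.Andre1996_hodgeClassesOnAbelianVarieties_motivated:
refutation-side no-go on abelian varieties; this line PROVES absoluteness beyond abelian type and
reproduces Deligne/André at toroidal Weil

History (route lifecycle, newest last):
- 2026-08-16T16:56:23Z · rev 1: restated Assembly (stmt-HodgeConjecture-15916) — crux-only repair 1/4: Assembly chain without the HodgeModels support (to be dropped; models conjunct moves into AbsoluteReduction) (planner-plan-novel-HodgeConjecture-HodgeConject-a5ea6484-v2-)
- 2026-08-16T16:56:43Z · rev 2: restated AbsoluteReduction (stmt-HodgeConjecture-15914) — crux-only repair 2/4: AbsoluteReduction carries the (proved) Hodge-model conjunct; closes now takes only BoundarySupply, BoundaryAbsoluteness, HCOverNumberField (planner-plan-novel-HodgeConjecture-HodgeConject-a5ea6484-v2-)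
- 2026-08-16T16:57:07Z · rev 3: dropped HodgeModels — crux-only repair 3/4: HodgeModels (copy of proved stmt-HodgeConjecture-1943) is no longer on the closing chain — the models conjunct is discharged inside Absolu (planner-plan-novel-HodgeConjecture-HodgeConject-a5ea6484-v2-)
- 2026-08-26T16:14:28Z · DORMANT — reconciler: no traction for 5.5 d (last activity item-evidence-added at 2026-08-21T04:16:45Z); parked, not closed — `ledger route dormant route-HodgeConjecture- (operator:999:367998)

sub-problem: HodgeConjecture · status: dormant · opened planner-plan-novel-HodgeConjecture-HodgeConject-a5ea6484-v2-g2-0 2026-08-16T16:54:15Z · rev 7 · ledger route-HodgeConjecture-BoundaryReadout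
GENERATED by the gate from the ledger (D-0016/17). Provers cite these decls: `theorem foo : Summit.HodgeConjecture.HodgeConjecture.Theses.BoundaryReadout.<Decl> := …` in Summits/HodgeConjecture/HodgeConjecture/Theorems/<Name>.lean.
-/

namespace Summit.HodgeConjecture.HodgeConjecture.Theses.BoundaryReadout

open scoped BigOperators Topology Manifold Classical MeasureTheory ProbabilityTheory Matrix InnerProductSpace ComplexConjugate ContinuousMap
open Filter Set Function TopologicalSpace MeasureTheory

attribute [summit_statement] _root_.HodgeConjecture

/-- item stmt-HodgeConjecture-15912 · crux · rank 2 · open · by planner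
why it might fail: Rigid classes (isolated in their Hodge locus) sit only in isotrivial families, where the statement is their absoluteness outright; movable loci may reach only boundaries carrying a full-dimensional component of unknown type. HC-safe: false only with Conj. 11.2.17.
sources: Voisin2007HodgeLoci, CattaniDeligneKaplan1995JAMS, arXiv:1601.08110, arXiv:2404.12422, ConteMurre1978, Deligne1982HodgeCycles
[crux] every rational (p,p) class c on a smooth projective X is e^*(ξ|X_t) for some ℂ-morphism e : X
→ X_t into a smooth projective fibre of some f : 𝒳 → C (𝒳 smooth projective, C a smooth projective
curve, f surjective), ξ a rational (p,p) class on 𝒳, such that the fibre over some o ∈ C(ℂ) is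
covered by finitely many smooth projective Y_i → X_o with every ξ|Y_i absolute Hodge (card K2 "cusp
supply" + K3 "cusp descent", ∃-form on the tree's real carriers; trivially true where c is already
known absolute — constant family — so its content is exactly the classes not known absolute:
degenerate inside the Hodge locus onto absolute-type pieces). [difficulty: open-problem] -/
@[route_item "route-HodgeConjecture-BoundaryReadout"]
def BoundarySupply : Prop :=
  ∀ ⦃n : ℕ⦄ ⦃X : Literature.AlgebraicGeometry.Motives.SchemeOver ℂ⦄, Literature.AlgebraicGeometry.Motives.IsSmoothProjective n X → ∀ (p : ℕ) (c : Literature.AlgebraicGeometry.HodgeTheory.complexBetti X (2 * p)), Literature.AlgebraicGeometry.HodgeTheory.IsRationalClass c → Literature.AlgebraicGeometry.HodgeTheory.IsOfHodgeType n X (2 * p) p p c → ∃ (N : ℕ) (𝒳 C : Literature.AlgebraicGeometry.Motives.SchemeOver ℂ) (f : 𝒳 ⟶ C) (o t : Literature.AlgebraicGeometry.Motives.AlgPoints C ℂ) (ι : Type) (_ : Finite ι) (m : ι → ℕ) (Y : ι → Literature.AlgebraicGeometry.Motives.SchemeOver ℂ) (g : ∀ i, Y i ⟶ Literature.AlgebraicGeometry.Motives.fiberOver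 f o) (ξ : Literature.AlgebraicGeometry.HodgeTheory.complexBetti 𝒳 (2 * p)) (n' : ℕ) (e : X ⟶ Literature.AlgebraicGeometry.Motives.fiberOver f t), Literature.AlgebraicGeometry.Motives.IsSmoothProjective N 𝒳 ∧ Literature.AlgebraicGeometry.Motives.IsSmoothProjective 1 C ∧ Function.Surjective f.left.base ∧ (∀ i, Literature.AlgebraicGeometry.Motives.IsSmoothProjective (m i) (Y i)) ∧ (∀ x : ↥(Literature.AlgebraicGeometry.Motives.fiberOver f o).left, ∃ (i : ι) (y : ↥(Y i).left), (g i).left.base y = x) ∧ Literature.AlgebraicGeometry.HodgeTheory.IsRationalClass ξ ∧ Literature.AlgebraicGeometry.HodgeTheory.IsOfHodgeType N 𝒳 (2 * p) p p ξ ∧ (∀ i, Literature.AlgebraicGeometry.HodgeTheory.IsAbsoluteHodgeClass (m i) (Y i) p (Literature.AlgebraicGeometry.HodgeTheory.complexBetti.map (CategoryTheory.CategoryStruct.comp (g i) (Literature.AlgebraicGeometry.Motives.fiberι f o)) (2 * p) ξ)) ∧ Literature.AlgebraicGeometry.Motives.IsSmoothProjective n' (Literature.AlgebraicGeometry.Motives.fiberOver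 f t) ∧ Literature.AlgebraicGeometry.HodgeTheory.complexBetti.map e (2 * p) (Literature.AlgebraicGeometry.HodgeTheory.complexBetti.map (Literature.AlgebraicGeometry.Motives.fiberι f t) (2 * p) ξ) = c

/-- item stmt-HodgeConjecture-15913 · crux · rank 3 · open · by planner
why it might fail: Unprinted theorem-candidate: needs sp : H(X_o) → H_lim a morphism of ℚ-MHS for NON-semistable fibres (via semistable base change), purity of the global part in H_lim, conjugation charts commuting with fibre inclusions; a ℚ-structure mismatch off ker N would leak.
sources: DeligneHodgeIII1974, Steenbrink1976, Clemens1977, Schmid1973, PetersSteenbrink2008, Voisin2007HodgeLoci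
[crux] BOUNDARY PRINCIPLE B (card K1, generalised: no semistability). f : 𝒳 → C surjective, 𝒳 smooth
projective of dim N, C a smooth projective curve, o ∈ C(ℂ); finitely many smooth projective Y_i →
X_o jointly covering the fibre; ξ ∈ H^2p(𝒳(ℂ);ℂ) rational of type (p,p) with every ξ|Y_i absolute
Hodge ⟹ ξ|X_t is absolute Hodge on every smooth projective fibre X_t. Proof sketch: for σ ∈ Aut ℂ,
ξ^σ|Y_i^σ = twist·(rational) by hypothesis; (r_i) = Gr^W_2p(ξ^σ|X_o^σ) (Hodge III 8.2); sp is a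
morphism of ℚ-MHS and sp(ξ^σ|X_o^σ) = image of ξ^σ in H_lim; that image lies in W'⊗ℂ, W' :=
im(H^2p(𝒳^σ) → H_lim) pure of weight 2p, so W'_ℚ ↪ Gr^W_2p H_lim,ℚ; a vector of W'⊗ℂ with rational
Gr-image is rational; F^p is preserved by σ on algebraic de Rham cohomology. [difficulty: L] -/
@[route_item "route-HodgeConjecture-BoundaryReadout"]
def BoundaryAbsoluteness : Prop :=
  ∀ (N p : ℕ) (𝒳 C : Literature.AlgebraicGeometry.Motives.SchemeOver ℂ) (f : 𝒳 ⟶ C) (o : Literature.AlgebraicGeometry.Motives.AlgPoints C ℂ), Literature.AlgebraicGeometry.Motives.IsSmoothProjective N 𝒳 → Literature.AlgebraicGeometry.Motives.IsSmoothProjective 1 C → Function.Surjective f.left.base → ∀ (ι : Type) [Finite ι] (m : ι → ℕ) (Y : ι → Literature.AlgebraicGeometry.Motives.SchemeOver ℂ) (g : ∀ i, Y i ⟶ Literature.AlgebraicGeometry.Motives.fiberOver f o), (∀ i, Literature.AlgebraicGeometry.Motives.IsSmoothProjective (m i) (Y i)) → (∀ x : ↥(Literature.AlgebraicGeometry.Motives.fiberOver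 f o).left, ∃ (i : ι) (y : ↥(Y i).left), (g i).left.base y = x) → ∀ ξ : Literature.AlgebraicGeometry.HodgeTheory.complexBetti 𝒳 (2 * p), Literature.AlgebraicGeometry.HodgeTheory.IsRationalClass ξ → Literature.AlgebraicGeometry.HodgeTheory.IsOfHodgeType N 𝒳 (2 * p) p p ξ → (∀ i, Literature.AlgebraicGeometry.HodgeTheory.IsAbsoluteHodgeClass (m i) (Y i) p (Literature.AlgebraicGeometry.HodgeTheory.complexBetti.map (CategoryTheory.CategoryStruct.comp (g i) (Literature.AlgebraicGeometry.Motives.fiberι f o)) (2 * p) ξ)) → ∀ (t : Literature.AlgebraicGeometry.Motives.AlgPoints C ℂ) (n : ℕ), Literature.AlgebraicGeometry.Motives.IsSmoothProjective n (Literature.AlgebraicGeometry.Motives.fiberOver f t) → Literature.AlgebraicGeometry.HodgeTheory.IsAbsoluteHodgeClass n (Literature.AlgebraicGeometry.Motives.fiberOver f t) p (Literature.AlgebraicGeometry.HodgeTheory.complexBetti.map (Literature.AlgebraicGeometry.Motives.fiberι f t) (2 * p) ξ)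

/-- item stmt-HodgeConjecture-1070 · crux · rank 4 · open · by planner
why it might fail: It is HC on ℚ̄-varieties: open already for Weil classes on CM abelian varieties of Weil type from dimension 6 on (failure there also refutes standard conjecture B, André); as typed it also asks Nonempty (HodgeModel n X).
sources: Deligne1982HodgeCycles, Andre1996Motifs, Voisin2007HodgeLoci, CharlesSchnell2014Notes, arXiv:2603.20268
[crux] The Hodge conjecture for smooth projective complex varieties definable over a number field (X
≅ X₀ ⊗_{K,σ} ℂ). Here a Hodge class has arithmetic incarnations absent at transcendental points: an
algebraic de Rham class over a finite extension of K (CharlesSchnell2014Notes Cor. 11.3.16 for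
absolute classes), crystalline Frobenii at good primes, one ℓ-adic Galois representation (Hodge ⇒
Tate under absoluteness; Tate + Mumford–Tate ⇒ HC for X/K, Moonen2017FamiliesMotives), p-adic
variational Hodge (BlochEsnaultKerz2014pAdic). Decisive open sub-family: CM abelian varieties of
Weil type (all over ℚ̄; by Deligne1982HodgeCycles + André 1992 every Hodge class on a CM abelian
variety comes from Weil classes) — algebraic in dim 4 and partly 6 (Markman2025SecantWeil,
arXiv:2603.20268), open beyond. -/
@[route_item "route-HodgeConjecture-BoundaryReadout"]
def HCOverNumberFields : Prop :=
  ∀ ⦃n : ℕ⦄ ⦃X : Literature.AlgebraicGeometry.Motives.SchemeOver ℂ⦄, Literature.AlgebraicGeometry.Motives.IsSmoothProjective n X → (∃ (K : Type) (_ : Field K) (_ : NumberField K) (σ : K →+* ℂ) (X₀ : Literature.AlgebraicGeometry.Motives.SchemeOver K), Nonempty (X ≅ (Literature.AlgebraicGeometry.Motives.baseChangeHom σ).obj X₀)) → Literature.AlgebraicGeometry.HodgeTheory.HodgeConjectureFor n X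

/-- item stmt-HodgeConjecture-1071 · crux · rank 9 · closed · proved by Summit.HodgeConjecture.HodgeConjecture.Theorems.boundaryReadout_pullbackAlgebraic_of_constantLift @ dac484460e49 (prover) · by planner
why it might fail: Theorem in print (Fulton Ch. 6, §8.1, §19; refined Gysin + purity), but on the tree's carriers algebraicClasses = Nᵖ (coniveau), so the proof needs the cycle class with supports; fails as typed only if Nᵖ H^{2p} ≠ span of cycle classes for some smooth projective W.
sources: Fulton1998, VoisinHodgeII2003, Deligne2000
[support] Pull-back along a ℂ-morphism ι : X ⟶ W of smooth projective varieties preserves algebraic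
classes: ι^*(Nᵖ H^{2p}(W(ℂ);ℂ)) ⊆ Nᵖ H^{2p}(X(ℂ);ℂ). Theorem in print: purity H^{2p}_T(W) spanned by
classes of codim-p components (Fulton §19.1), refined Gysin pull-back ι^! : CH_*(W) → CH_*(X) for W
smooth (Fulton Ch. 6 and §8.1, no moving lemma needed) and compatibility cl(ι^! z) = ι^* cl(z)
(Fulton Cor. 19.2 / Prop. 19.2.2); on the tree's carriers it needs the cycle class with supports
(same obligation as HodgeTheory/AlgebraicClassesCup 'moving' hypothesis). -/
@[route_item "route-HodgeConjecture-BoundaryReadout"]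
def PullbackAlgebraic : Prop :=
  ∀ ⦃n : ℕ⦄ ⦃X : Literature.AlgebraicGeometry.Motives.SchemeOver ℂ⦄, Literature.AlgebraicGeometry.Motives.IsSmoothProjective n X → ∀ ⦃m : ℕ⦄ ⦃W : Literature.AlgebraicGeometry.Motives.SchemeOver ℂ⦄, Literature.AlgebraicGeometry.Motives.IsSmoothProjective m W → ∀ (ι : X ⟶ W) (p : ℕ) (c' : Literature.AlgebraicGeometry.HodgeTheory.complexBetti W (2 * p)), c' ∈ Literature.AlgebraicGeometry.HodgeTheory.algebraicClasses W p → Literature.AlgebraicGeometry.HodgeTheory.complexBetti.map ι (2 * p) c' ∈ Literature.AlgebraicGeometry.HodgeTheory.algebraicClasses X p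

-- `PullbackAlgebraic` holds: proved by `Summit.HodgeConjecture.HodgeConjecture.Theorems.boundaryReadout_pullbackAlgebraic_of_constantLift` @ dac484460e49 (its module imports this route file, so no `_holds` link can be stated here).

-- earlier AbsoluteReduction (stmt-HodgeConjecture-15914, replaced 2026-08-16T16:56:43Z -> stmt-HodgeConjecture-15945): retired by None — HCOverNumberFields → ∀ ⦃n : ℕ⦄ ⦃X : Literature.AlgebraicGeometry.Motives.SchemeOver ℂ⦄, Literature.AlgebraicGeometry.Motives.IsSmoothProjective n X → ∀ (p : ℕ) (c : Literature.AlgebraicGeometry.HodgeTheory.complexBetti X (2 * p)), Literature.AlgebraicGeometry.Hodge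
/-- item stmt-HodgeConjecture-15945 · crux · rank 9 · open · by planner
why it might fail: Theorem in print (Voisin 2007 Prop. 1.2), unformalised: needs spreading over ℚ̄, the global invariant cycle theorem with semisimple splitting, and the tree's de Rham IsAbsoluteHodgeClass (conjugation charts) to match Voisin's notion; fails as typed only if that dictionary leaks.
sources: Voisin2007HodgeLoci, CharlesSchnell2014Notes, DeligneHodgeII1971, KerrPearlstein2016
[support→crux] Voisin2007HodgeLoci Prop. 1.2 (theorem in print; CharlesSchnell2014Notes Thm
11.3.19): HC over number fields ⟹ every (de Rham) absolute Hodge class on a smooth projective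
complex variety is algebraic (spread over ℚ̄, ℚ̄-compactify, global invariant cycle theorem +
semisimplicity, HC(ℚ̄), restrict); bundled with the PROVED Hodge-model existence (tree fact
HodgeTheory.nonempty_hodgeModel_holds) as first conjunct so that the deciding theorem is crux-only. -/
@[route_item "route-HodgeConjecture-BoundaryReadout"]
def AbsoluteReduction : Prop :=
  HCOverNumberFields → ∀ ⦃n : ℕ⦄ ⦃X : Literature.AlgebraicGeometry.Motives.SchemeOver ℂ⦄, Literature.AlgebraicGeometry.Motives.IsSmoothProjective n X → Nonempty (Literature.AlgebraicGeometry.HodgeTheory.HodgeModel n X) ∧ ∀ (p : ℕ) (c : Literature.AlgebraicGeometry.HodgeTheory.complexBetti X (2 * p)), Literature.AlgebraicGeometry.HodgeTheory.IsAbsoluteHodgeClass n X p c → c ∈ Literature.AlgebraicGeometry.HodgeTheory.algebraicClasses X p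

/-- item stmt-HodgeConjecture-18339 · support · rank 9 · open · by planner
[support] CONJUGATES EXIST (σ-infrastructure theorem in print; verbatim stub_conjugate_exists of the
active skeleton Cruxes/BoundaryAbsoluteness/Lines/typewise_readout.lean and of
Cruxes/HCOverNumberFields/Lines/birth.lean — ONE shared item for both cruxes): for X smooth
projective over ℂ, every σ ∈ Aut ℂ, every degree k and every c ∈ Hᵏ(X(ℂ);ℂ) there is a σ-conjugate
class c' on X^σ in some conjugation chart (IsConjugateClass): Jouanolou's affine torsor Y → X (Lemme
1.5), GAGA analytifications of Y and Y^σ on one model space, a natural rationally normalised complex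
de Rham family (discharged: exists_isRational_complexDeRhamIsoFamily_holds), Grothendieck's
comparison on the smooth affine Y (Thm 1'). In the tree: stub_conjugate_exists_of_JGC (hJ hG hC)
from the named facts jouanolou_cohomologyChart, grothendieck_comparison_realize_surjective,
conj_realize_mem_cclosedSmoothForms
(Literature/AlgebraicGeometry/HodgeTheory/ConjugationChartExistence.lean). Unavoidable:
Theorems/BoundaryAbsoluteness/Negative/HCSafety.nonempty_conjugationChart_fibre_of_boundaryAbsoluteness.
WHY IT MIGHT FAIL: Theorem in print; fails only through the carriers: realised closed algebraic
forms must be C¹ and -/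
@[route_item "route-HodgeConjecture-BoundaryReadout"]
def ConjugateClassesExist : Prop :=
  ∀ ⦃n : ℕ⦄ ⦃X : Literature.AlgebraicGeometry.Motives.SchemeOver ℂ⦄, Literature.AlgebraicGeometry.Motives.IsSmoothProjective n X → ∀ (σ : ℂ ≃+* ℂ) (k : ℕ) (c : Literature.AlgebraicGeometry.HodgeTheory.complexBetti X k), ∃ c', Literature.AlgebraicGeometry.HodgeTheory.IsConjugateClass σ X k c c'

/-- item stmt-HodgeConjecture-18340 · support · rank 9 · open · by planner
[support] CONJUGATION IS NATURAL AND SINGLE-VALUED (σ-infrastructure; verbatim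
stub_conjugateNaturality of the active skeleton Lines/typewise_readout.lean v3): for g : Y ⟶ X
between smooth projective complex varieties, σ ∈ Aut ℂ, c ∈ Hᵏ(X(ℂ);ℂ), any σ-conjugate c' of c (any
chart on X) and any σ-conjugate d' of g^*c (any chart on Y): d' = (g^σ)^* c'. At g = 𝟙 it is
single-valuedness of chart conjugation (Negative/ChartConjugationUniqueness). Charles–Schnell
§11.2.2: conjugation of algebraic de Rham cohomology is functorial; in the tree it is
conjugateNaturality_of_canonical (hN : chartConjugation_canonical)
(Theorems/BoundaryReadoutBoundaryAbsolutenessConjugateNaturality.lean, fact N of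
Literature/AlgebraicGeometry/HodgeTheory/ConjugationChartUniqueness.lean). Content of N beyond
J/G/C: Grothendieck INJECTIVITY on smooth affines (conjugation descends to classes), lifting of
affine charts through the Jouanolou torsor, and a GAUGE-PINNING lemma (a natural ℂ-linear
automorphism of Hᵏ(−;ℂ) on manifolds charted on one model space that preserves torus-rationality is
a rational scalar on the classes met — pseudomanifold carriers + regular neighbourhoods; see
Cruxes/BoundaryAbsoluteness/ST -/
@[route_item "route-HodgeConjecture-BoundaryReadout"]
def ConjugationNatural : Prop :=
  ∀ ⦃m n : ℕ⦄ ⦃Y X : Literature.AlgebraicGeometry.Motives.SchemeOver ℂ⦄, Literature.AlgebraicGeometry.Motives.IsSmoothProjective m Y → Literature.AlgebraicGeometry.Motives.IsSmoothProjective n X → ∀ (g : Y ⟶ X) (σ : ℂ ≃+* ℂ) (k : ℕ) (c : Literature.AlgebraicGeometry.HodgeTheory.complexBetti X k) (c' : Literature.AlgebraicGeometry.HodgeTheory.complexBetti (Literature.AlgebraicGeometry.Motives.conjugateVariety σ X) k) (d' : Literature.AlgebraicGeometry.HodgeTheory.complexBetti (Literature.AlgebraicGeometry.Motives.conjugateVariety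 σ Y) k), Literature.AlgebraicGeometry.HodgeTheory.IsConjugateClass σ X k c c' → Literature.AlgebraicGeometry.HodgeTheory.IsConjugateClass σ Y k (Literature.AlgebraicGeometry.HodgeTheory.complexBetti.map g k c) d' → d' = Literature.AlgebraicGeometry.HodgeTheory.complexBetti.map (Literature.AlgebraicGeometry.HodgeTheory.conjHom σ g) k c'

-- earlier Assembly (stmt-HodgeConjecture-15916, replaced 2026-08-16T16:56:23Z -> stmt-HodgeConjecture-15933): retired by None — BoundarySupply → BoundaryAbsoluteness → HCOverNumberFields → AbsoluteReduction → PullbackAlgebraic → HodgeModels → _root_.HodgeConjecture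
/-- item stmt-HodgeConjecture-15933 · assembly · rank 1 · closed · proved by Summit.HodgeConjecture.HodgeConjecture.Theorems.boundaryReadout_assembly_proof @ 56db29b4b4db (prover) · by planner
sources: Voisin2007HodgeLoci, Deligne1982HodgeCycles
[assembly] BoundarySupply → BoundaryAbsoluteness → HCOverNumberFields → AbsoluteReduction →
PullbackAlgebraic → HodgeConjecture (pure logic; the proof of `closes`; Hodge-model existence is the
first conjunct of AbsoluteReduction). -/
@[route_item "route-HodgeConjecture-BoundaryReadout"]
def Assembly : Prop :=
  BoundarySupply → BoundaryAbsoluteness → HCOverNumberFields → AbsoluteReduction → PullbackAlgebraic → _root_.HodgeConjecture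

-- `Assembly` holds: proved by `Summit.HodgeConjecture.HodgeConjecture.Theorems.boundaryReadout_assembly_proof` @ 56db29b4b4db (its module imports this route file, so no `_holds` link can be stated here).

/-! D-0027 §2.1 — DECIDING THEOREM (planner-authored via `route open/edit --closes-file`; by planner-rbadge-HodgeConjecture-BoundaryReadout-0bba784c-0 2026-08-16T17:04:05Z):
its hypotheses are this route's items and its conclusion the sub-problem Statement (glue_lint), and it elaborates with this file. -/

@[closes "route-HodgeConjecture-BoundaryReadout"] theorem closes (hS : BoundarySupply) (hB : BoundaryAbsoluteness) (hQ : HCOverNumberFields)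
    (hR : AbsoluteReduction) (hP : PullbackAlgebraic) : _root_.HodgeConjecture := by
  intro n X hX
  -- anti-vacuity conjunct of `HodgeConjectureFor`: Hodge models exist (first conjunct of AbsoluteReduction)
  refine ⟨(hR hQ hX).1, fun p c hc hpp => ?_⟩
  -- supply: c = e^*(ξ|X_t), the fibre X_o being covered by pieces Y_i on which ξ is absolute Hodge
  obtain ⟨N, 𝒳, C, f, o, t, ι, hι, m, Y, g, ξ, n', e, h𝒳, hC, hf, hY, hcov, hξr, hξh, habs, ht, hc'⟩ :=
    hS hX p c hc hpp
  haveI : Finite ι := hι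
  -- boundary readout: ξ|X_t is absolute Hodge on the smooth projective fibre X_t
  have key := hB N p 𝒳 C f o h𝒳 hC hf ι m Y g hY hcov ξ hξr hξh habs t n' ht
  -- Voisin's funnel: absolute Hodge + HC over number fields ⇒ algebraic on X_t; then pull back along e
  rw [← hc']
  exact hP hX ht e p _ ((hR hQ ht).2 p _ key)

end Summit.HodgeConjecture.HodgeConjecture.Theses.BoundaryReadout
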